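import Literature.ModelTheory.Quasiminimal.Excellence
import HarnessLib

/-!
# Partial embeddings on crowns extend to automorphisms (Kirby 2010, Lemma 3.2, from BHHKK's excellence)

J. Kirby, *On quasiminimal excellent classes*, J. Symbolic Logic 75 (2010), Lemma 3.2
("Excellence – Shelah style"): in a quasiminimal excellent class, a closed partial embedding
`f : H ⇀ H'` whose domain is a countable crown `C` extends to a closed embedding of `cl_H(C)`.
M. Bays, B. Hart, T. Hyttinen, M. Kesälä, J. Kirby, *Quasiminimal structures and excellence*,
Bull. LMS 46 (2014), Prop. 6.2, proves the excellence axiom used there for every (weakly)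
quasiminimal pregeometry structure: types over crowns are s-isolated, and tuples with the same
type over a crown are conjugate over it (`Excellence.lean`:
`IsWeaklyQuasiminimalPregeometryStructure.excellentOver_crown`).

This file proves Kirby's Lemma 3.2 in the following **one-structure, automorphism form**, which
is the form used in the uniqueness-of-large-models argument (Kirby 2010, Thm 3.3 — the maps `e`
and the extension of `g_X` from the crown `⋃ᵢ cl_H(G Yᵢ)` to `cl_H(G X)`) once both structures
are identified along an isomorphism matching the bases:

* `IsWeaklyQuasiminimalPregeometryStructure.exists_equiv_extend_crown` — let `M` be a countable
  weakly quasiminimal pregeometry structure with a basis `b : ℕ → M`, `S` a nonempty finite set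
  of indices with crown `∂_S M = ⋃_{i ∈ S} cl (b[ℕ ∖ {i}])`, and `γ : M ⇀ M` a partial embedding
  on `∂_S M` mapping every face `∂ᵢ M` (`i ∈ S`) onto itself and fixing the basis. Then `γ`
  extends to an automorphism of `M` (fixing the basis).

The proof is by induction on `|S|`. For `S = {i}` the crown is the closed set `∂ᵢM` and
`γ ∪ {bᵢ ↦ bᵢ}` extends by uniqueness of the generic type and the successor step of Kirby's
Thm 2.1 (`exists_isQFEmbOn_cl_extend`). For `|S| ≥ 2` pick `i₀ ∈ S`, `T = S ∖ {i₀}`; by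
induction `γ|∂_T` extends to an automorphism `Γ_T`, and replacing `γ` by `Γ_T⁻¹ ∘ γ` we may
assume `γ = id` on `∂_T M`. Then `γ` is extended through a countable back-and-forth
(`exists_equiv_extend_crown_step`) whose one-point step (`crown_forth`) is Kirby's: the type of
the current finite tuple plus the new point over the crown `∂_S M` is s-isolated over a finite
`A₀` (BHHKK Prop. 6.2 (i)); a partner for the new point is obtained from an automorphism over
`∂_T M` (BHHKK Prop. 6.2 (ii), or Kirby's Prop. 2.3 when `T` is a singleton) matching the tuple
and the finitely many parameters of `A₀` in the twisted face `∂_{i₀}`; that the extended finite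
map is again compatible with `γ` over the whole crown is checked by moving the parameters of
`∂_{i₀}` back along such automorphisms and invoking the s-isolation.

Everything here is proved; no new definitions are introduced.

## References

* J. Kirby, *On quasiminimal excellent classes*, J. Symbolic Logic 75 (2010) 551–564,
  arXiv:0707.4496: Def. 1.1 (axiom III), Lemma 3.2, Thm 3.3 (proof).
* M. Bays, B. Hart, T. Hyttinen, M. Kesälä, J. Kirby, *Quasiminimal structures and excellence*,
  Bull. London Math. Soc. 46 (2014) 155–163, arXiv:1210.2008: Prop. 6.2, Thm 2.3 (proof).
-/

noncomputable section

open Set FirstOrder FirstOrder.Language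

universe u v w

namespace Literature.ModelTheory.Quasiminimal

variable {L : Language.{u, v}} {M : Type w} [L.Structure M] {cl : Set M → Set M}

/-! ### Tuple bookkeeping -/

section Tuples

omit [L.Structure M] in
/-- Maps distribute over `Fin.append`. [folklore] -/
theorem comp_append' {N : Type*} (f : M → N) {m n : ℕ} (a : Fin m → M) (c : Fin n → M) :
    f ∘ Fin.append a c = Fin.append (f ∘ a) (f ∘ c) := by
  funext i
  refine Fin.addCases (fun j => ?_) (fun j => ?_) i <;> simp

/-- Applying a partial embedding on `univ` (an endomorphism preserving quantifier-free types of
all finite tuples) to the right-hand tuple. [folklore] -/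
theorem _root_.FirstOrder.Language.EqQFType.map_right {θ : M → M} (hθ : IsQFEmbOn L θ univ)
    {n : ℕ} {x y : Fin n → M} (h : L.EqQFType x y) : L.EqQFType x (θ ∘ y) :=
  h.trans (hθ y fun _ => mem_univ _)

/-- Applying a partial embedding on `univ` to the left-hand tuple. [folklore] -/
theorem _root_.FirstOrder.Language.EqQFType.map_left {θ : M → M} (hθ : IsQFEmbOn L θ univ)
    {n : ℕ} {x y : Fin n → M} (h : L.EqQFType x y) : L.EqQFType (θ ∘ x) y :=
  (hθ x fun _ => mem_univ _).symm.trans h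

/-- `EqQFTypeOver P γ` with a block of parameters from `P` moved into the matched tuples:
from `qftp(P, d) = qftp(γ P, d')` get `qftp(P, u, d) = qftp(γ P, γ u, d')` for `u ⊆ P`.
[folklore] -/
theorem _root_.FirstOrder.Language.EqQFTypeOver.append_params {P : Set M} {γ : M → M} {n p : ℕ}
    {d d' : Fin n → M} (h : L.EqQFTypeOver P γ d d') {u : Fin p → M} (hu : ∀ i, u i ∈ P) :
    L.EqQFTypeOver P γ (Fin.append u d) (Fin.append (γ ∘ u) d') := by
  intro m σ hσ
  have hmem : ∀ i, Fin.append σ u i ∈ P := fun i => by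
    refine Fin.addCases (fun j => ?_) (fun j => ?_) i
    · simpa using hσ j
    · simpa using hu j
  have key := h (Fin.append σ u) hmem
  rw [comp_append', Fin.append_assoc, Fin.append_assoc] at key
  have := key.comp (Fin.cast (Nat.add_assoc m p n).symm)
  refine this.congr ?_ ?_ <;> funext i <;> simp

/-- Restricting the parameter set of `EqQFTypeOver P γ` to a part `Q ⊆ P` fixed pointwise by `γ`
gives `EqQFTypeOver Q id`. [folklore] -/
theorem _root_.FirstOrder.Language.EqQFTypeOver.to_id_of_fixed {P Q : Set M} {γ : M → M} {n : ℕ}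
    {d d' : Fin n → M} (h : L.EqQFTypeOver P γ d d') (hQP : Q ⊆ P) (hfix : ∀ z ∈ Q, γ z = z) :
    L.EqQFTypeOver Q id d d' := by
  intro m σ hσ
  have key := h σ fun i => hQP (hσ i)
  have e : γ ∘ σ = σ := funext fun i => hfix _ (hσ i)
  rw [e] at key
  simpa using key

end Tuples

/-! ### Crowns: small facts -/

section Crowns

variable {b : ℕ → M}

/-- The crown of a single index is the face. [folklore] -/
theorem crown_singleton (i : ℕ) : crown cl b {i} = face cl b i := by
  simp [crown]

/-- A crown is the smaller crown plus the removed face. [folklore] -/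
theorem crown_eq_union_erase {S : Finset ℕ} {i₀ : ℕ} (hi₀ : i₀ ∈ S) :
    crown cl b S = crown cl b (S.erase i₀) ∪ face cl b i₀ := by
  ext x
  simp only [mem_crown_iff, mem_union, Finset.mem_erase]
  constructor
  · rintro ⟨i, hi, hx⟩
    by_cases h : i = i₀
    · subst h; exact Or.inr hx
    · exact Or.inl ⟨i, ⟨h, hi⟩, hx⟩
  · rintro (⟨i, ⟨-, hi⟩, hx⟩ | hx)
    · exact ⟨i, hi, hx⟩
    · exact ⟨i₀, hi₀, hx⟩

/-- A point of the crown outside the face `∂_{i₀}` lies in the smaller crown. [folklore] -/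
theorem mem_crown_erase_of_notMem_face {S : Finset ℕ} {i₀ : ℕ} (hi₀ : i₀ ∈ S) {x : M}
    (hx : x ∈ crown cl b S) (hxF : x ∉ face cl b i₀) : x ∈ crown cl b (S.erase i₀) := by
  rw [crown_eq_union_erase hi₀] at hx
  exact hx.resolve_right hxF

/-- With at least two indices every basis vector lies in the crown. [folklore] -/
theorem apply_mem_crown_of_two_le (h : IsPregeometry cl) {S : Finset ℕ} (hS : 2 ≤ S.card) (j : ℕ) :
    b j ∈ crown cl b S := by
  obtain ⟨i, hi, hij⟩ : ∃ i ∈ S, i ≠ j := by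
    by_contra hcon
    push Not at hcon
    have : S ⊆ {j} := fun i hi => Finset.mem_singleton.2 (hcon i hi)
    have := Finset.card_le_card this
    rw [Finset.card_singleton] at this
    omega
  exact apply_mem_crown h hi hij.symm

/-- A basis vector `b j` lies in the crown of `T` as soon as `T` is nonempty and `j ∉ T` (then any
`i ∈ T` differs from `j`). [folklore] -/
theorem apply_mem_crown_of_notMem (h : IsPregeometry cl) {T : Finset ℕ} (hT : T.Nonempty) {j : ℕ}
    (hj : j ∉ T) : b j ∈ crown cl b T := by
  obtain ⟨i, hi⟩ := hT
  exact apply_mem_crown h hi (fun hji => hj (hji ▸ hi))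

/-- The closure of a face together with its missing basis vector is everything. [folklore] -/
theorem cl_face_union_singleton (h : IsPregeometry cl) (hsp : cl (range b) = univ) (i : ℕ) :
    cl (face cl b i ∪ range ![b i]) = univ := by
  have e : range ![b i] = b '' {i} := by
    simp [Matrix.range_cons, Matrix.range_empty]
  rw [face, e]
  exact cl_cl_image_union_image h hsp (fun j => by by_cases hj : j = i <;> simp [hj])

/-- **Automorphisms fixing the other basis vectors preserve a face**: if `π` is a partial
embedding on `univ` with `π (b j) = b j` for all `j ≠ i` then `π '' ∂ᵢ = ∂ᵢ`. [folklore] -/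
theorem image_face_eq_of_fix (hW : IsWeaklyQuasiminimalPregeometryStructure L M cl) {π : M ≃ M}
    (hπ : IsQFEmbOn L π univ) {i : ℕ} (hfix : ∀ j, j ≠ i → π (b j) = b j) :
    π '' face cl b i = face cl b i := by
  rw [face, hW.equiv_image_cl hπ]
  congr 1
  ext x
  constructor
  · rintro ⟨_, ⟨j, hj, rfl⟩, rfl⟩
    exact ⟨j, hj, (hfix j hj).symm⟩
  · rintro ⟨j, hj, rfl⟩
    exact ⟨b j, ⟨j, hj, rfl⟩, hfix j hj⟩

end Crowns

/-! ### Conjugacy and isolation over crowns (BHHKK Prop. 6.2, packaged) -/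

namespace IsWeaklyQuasiminimalPregeometryStructure

variable {b : ℕ → M}

/-- **Conjugacy over a nonempty crown**: tuples with the same quantifier-free type over
`∂_T M` (`T ≠ ∅`) are conjugate by an automorphism fixing `∂_T M` pointwise — BHHKK 2014,
Prop. 6.2 (ii) for `|T| ≥ 2`, and Kirby 2010, Prop. 2.3 over the closed face when `T = {i}`.
[cite: BHHKK2014, Prop. 6.2 (ii)] [cite: Kirby2010QMEC, Prop. 2.3] -/
theorem exists_equiv_of_eqQFTypeOver_crown [Countable M]
    (hW : IsWeaklyQuasiminimalPregeometryStructure L M cl) (hb : IndepFamilyOver cl ∅ b)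
    (hsp : cl (range b) = univ) {T : Finset ℕ} (hT : T.Nonempty) {n : ℕ} {x y : Fin n → M}
    (h : L.EqQFTypeOver (crown cl b T) id x y) :
    ∃ π : M ≃ M, IsQFEmbOn L π univ ∧ (∀ z ∈ crown cl b T, π z = z) ∧ ∀ i, π (x i) = y i := by
  by_cases hT2 : 2 ≤ T.card
  · exact (hW.excellentOver_crown hb hsp hT2).2 x y h
  · obtain ⟨i, rfl⟩ : ∃ i, T = {i} := by
      have h1 : T.card = 1 := by
        have := Finset.card_pos.2 hT
        omega
      exact Finset.card_eq_one.1 h1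
    rw [crown_singleton] at h ⊢
    exact hW.exists_equiv_of_eqQFTypeOver (Or.inl (cl_face hW.isPregeometry b i)) h

/-- **s-isolation over a crown with at least two indices** (BHHKK 2014, Prop. 6.2 (i)).
[cite: BHHKK2014, Prop. 6.2 (i)] -/
theorem exists_isolating_over_crown [Countable M]
    (hW : IsWeaklyQuasiminimalPregeometryStructure L M cl) (hb : IndepFamilyOver cl ∅ b)
    (hsp : cl (range b) = univ) {S : Finset ℕ} (hS : 2 ≤ S.card) {m : ℕ} (x : Fin m → M) :
    ∃ A₀ : Set M, A₀.Finite ∧ A₀ ⊆ crown cl b S ∧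
      ∀ c : Fin m → M, L.EqQFTypeOver A₀ id x c → L.EqQFTypeOver (crown cl b S) id x c :=
  (hW.excellentOver_crown hb hsp hS).1 x

/-! ### The one-point step of the back-and-forth (Kirby 2010, Lemma 3.2, forth) -/

/-- **Forth step.** Let `S ∋ i₀` with `T = S ∖ {i₀}` nonempty, and let `γ` be a partial embedding
on the crown `∂_S M` which is the identity on `∂_T M`, maps the face `∂_{i₀}` onto itself and
fixes the basis. If `qftp(∂_S, d) = qftp(γ ∂_S, d')` (that is, `γ ∪ (d ↦ d')` is a partial
embedding) then for every `a` there is `a'` with `qftp(∂_S, d, a) = qftp(γ ∂_S, d', a')`.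
This is the odd step of the back-and-forth in Kirby 2010, Lemma 3.2, with "the quantifier-free
type of `(d, a)` over `C` is determined over `C₀`" supplied by BHHKK 2014, Prop. 6.2.
[cite: Kirby2010QMEC, Lemma 3.2 (proof)] [cite: BHHKK2014, Prop. 6.2] -/
theorem crown_forth [Countable M]
    (hW : IsWeaklyQuasiminimalPregeometryStructure L M cl) (hb : IndepFamilyOver cl ∅ b)
    (hsp : cl (range b) = univ) {S : Finset ℕ} {i₀ : ℕ} (hi₀ : i₀ ∈ S)
    (hT : (S.erase i₀).Nonempty) {γ : M → M}
    (hγT : ∀ z ∈ crown cl b (S.erase i₀), γ z = z) (hγF : γ '' face cl b i₀ = face cl b i₀)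
    (hγb : ∀ j, γ (b j) = b j) {n : ℕ} {d d' : Fin n → M}
    (hJ : L.EqQFTypeOver (crown cl b S) γ d d') (a : M) :
    ∃ a' : M, L.EqQFTypeOver (crown cl b S) γ (Fin.snoc d a : Fin (n + 1) → M) (Fin.snoc d' a') := by
  classical
  have hP := hW.isPregeometry
  set T := S.erase i₀ with hTdef
  have hS2 : 2 ≤ S.card := by
    have h1 := Finset.card_pos.2 hT
    rw [hTdef, Finset.card_erase_of_mem hi₀] at h1
    omega
  have hTS : crown cl b T ⊆ crown cl b S := crown_mono (Finset.erase_subset _ _)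
  have hFS : face cl b i₀ ⊆ crown cl b S := face_subset_crown hi₀
  -- (i) s-isolation of `tp((d, a) / ∂_S)` over a finite `A₀`
  obtain ⟨A₀, hA₀fin, hA₀S, hiso⟩ :=
    hW.exists_isolating_over_crown hb hsp hS2 (Fin.snoc d a : Fin (n + 1) → M)
  -- the parameters of `A₀` in the twisted face, together with the basis vectors `b j`, `j ∈ T`
  set U : Set M := (A₀ ∩ face cl b i₀) ∪ b '' (↑T : Set ℕ) with hUdef
  have hUfin : U.Finite := (hA₀fin.inter_of_left _).union ((Finset.finite_toSet T).image b)
  obtain ⟨p, u₀, hu₀⟩ := hUfin.fin_embedding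
  have hu₀U : ∀ i, u₀ i ∈ U := fun i => hu₀ ▸ mem_range_self i
  have hUF : U ⊆ face cl b i₀ := by
    rintro z (⟨-, hz⟩ | ⟨j, hj, rfl⟩)
    · exact hz
    · exact apply_mem_face hP (Finset.ne_of_mem_erase (Finset.mem_coe.1 hj))
  have hu₀F : ∀ i, u₀ i ∈ face cl b i₀ := fun i => hUF (hu₀U i)
  have hu₀S : ∀ i, u₀ i ∈ crown cl b S := fun i => hFS (hu₀F i)
  -- (ii) an automorphism over `∂_T` realising `d ↦ d'`, `u₀ ↦ γ u₀`
  have h1 : L.EqQFTypeOver (crown cl b T) id (Fin.append d u₀) (Fin.append d' (γ ∘ u₀)) :=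
    ((hJ.append_params hu₀S).append_swap).to_id_of_fixed hTS hγT
  obtain ⟨π, hπ, hπT, hπdu⟩ := hW.exists_equiv_of_eqQFTypeOver_crown hb hsp hT h1
  have hπd : ∀ i, π (d i) = d' i := fun i => by simpa using hπdu (Fin.castAdd p i)
  have hπu : ∀ i, π (u₀ i) = γ (u₀ i) := fun i => by simpa using hπdu (Fin.natAdd n i)
  have hπsymm := isQFEmbOn_symm hπ
  -- `π` fixes every `b j`, `j ≠ i₀`, hence preserves the face `∂_{i₀}`
  have hπb : ∀ j, j ≠ i₀ → π (b j) = b j := by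
    intro j hj
    by_cases hjS : j ∈ S
    · have hjT : j ∈ T := Finset.mem_erase.2 ⟨hj, hjS⟩
      have : b j ∈ U := Or.inr ⟨j, Finset.mem_coe.2 hjT, rfl⟩
      rw [← hu₀] at this
      obtain ⟨i, hi⟩ := this
      rw [← hi, hπu i, hi, hγb j]
    · have hjT : j ∉ T := fun h => hjS (Finset.mem_of_mem_erase h)
      exact hπT _ (apply_mem_crown_of_notMem hP hT hjT)
  have hπF : π '' face cl b i₀ = face cl b i₀ := image_face_eq_of_fix hW hπ hπb
  have hπsF : π.symm '' face cl b i₀ = face cl b i₀ := Equiv.symm_image_eq_of_image_eq hπF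
  -- the partner
  refine ⟨π a, ?_⟩
  intro m σ hσ
  -- move the parameters back: `v = π⁻¹ γ σ`, again parameters of the crown
  set v : Fin m → M := fun i => π.symm (γ (σ i)) with hvdef
  have hvS : ∀ i, v i ∈ crown cl b S := by
    intro i
    by_cases hiF : σ i ∈ face cl b i₀
    · have : γ (σ i) ∈ face cl b i₀ := by rw [← hγF]; exact mem_image_of_mem γ hiF
      have : π.symm (γ (σ i)) ∈ face cl b i₀ := by rw [← hπsF]; exact mem_image_of_mem _ this
      exact hFS this
    · have hiT : σ i ∈ crown cl b T := mem_crown_erase_of_notMem_face hi₀ (hσ i) hiF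
      have : v i = σ i := by
        simp only [hvdef, hγT _ hiT, Equiv.symm_apply_eq]
        exact (hπT _ hiT).symm
      rw [this]; exact hσ i
  have hπv : ∀ i, π (v i) = γ (σ i) := fun i => by simp [hvdef]
  -- `qftp(∂_T, σ, u₀, d) = qftp(∂_T, v, u₀, d)`
  have h2 : L.EqQFTypeOver (crown cl b T) id (Fin.append (Fin.append σ u₀) d)
      (Fin.append (Fin.append v u₀) d) := by
    intro k τ hτ
    have hmem : ∀ i, Fin.append τ (Fin.append σ u₀) i ∈ crown cl b S := fun i => by
      refine Fin.addCases (fun j => ?_) (fun j => ?_) i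
      · simpa using hTS (hτ j)
      · refine Fin.addCases (fun l => ?_) (fun l => ?_) j
        · simpa using hσ l
        · simpa using hu₀S l
    have key := hJ (Fin.append τ (Fin.append σ u₀)) hmem
    -- apply `π⁻¹` to the right-hand side
    have key' := key.map_right hπsymm
    have e : (π.symm : M → M) ∘ Fin.append (γ ∘ Fin.append τ (Fin.append σ u₀)) d' =
        Fin.append (Fin.append τ (Fin.append v u₀)) d := by
      rw [comp_append', comp_append', comp_append', comp_append', comp_append']
      congr 1
      · congr 1
        · funext j
          have hτT := hτ j
          simp only [Function.comp_apply, hγT _ hτT, Equiv.symm_apply_eq]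
          exact (hπT _ hτT).symm
        · congr 1
          funext l
          simp only [Function.comp_apply, Equiv.symm_apply_eq]
          exact (hπu l).symm
      · funext j
        simp only [Function.comp_apply, Equiv.symm_apply_eq]
        exact (hπd j).symm
    rw [e] at key'
    -- reassociate both sides in the same way
    have ea : ∀ w : Fin m → M, Fin.append (Fin.append τ (Fin.append w u₀)) d =
        Fin.append τ (Fin.append (Fin.append w u₀) d) ∘ Fin.cast (Nat.add_assoc k (m + p) n) :=
      fun w => Fin.append_assoc _ _ _
    rw [ea σ, ea v] at key'
    have := key'.comp (Fin.cast (Nat.add_assoc k (m + p) n).symm)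
    simp only [Function.id_comp]
    refine this.congr ?_ ?_ <;> funext i <;> simp
  obtain ⟨ρ, hρ, hρT, hρx⟩ := hW.exists_equiv_of_eqQFTypeOver_crown hb hsp hT h2
  have hρσ : ∀ i, ρ (σ i) = v i := fun i => by
    simpa using hρx (Fin.castAdd n (Fin.castAdd p i))
  have hρu : ∀ i, ρ (u₀ i) = u₀ i := fun i => by
    simpa using hρx (Fin.castAdd n (Fin.natAdd m i))
  have hρd : ∀ i, ρ (d i) = d i := fun i => by
    simpa using hρx (Fin.natAdd (m + p) i)
  have hρsymm := isQFEmbOn_symm hρ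
  -- `ρ` fixes `A₀` pointwise
  have hρA₀ : ∀ z ∈ A₀, ρ z = z := by
    intro z hz
    by_cases hzF : z ∈ face cl b i₀
    · have : z ∈ U := Or.inl ⟨hz, hzF⟩
      rw [← hu₀] at this
      obtain ⟨i, rfl⟩ := this
      exact hρu i
    · exact hρT _ (mem_crown_erase_of_notMem_face hi₀ (hA₀S hz) hzF)
  -- hence `tp((d, ρ a) / A₀) = tp((d, a) / A₀)`, and by isolation over the whole crown
  have h3 : L.EqQFTypeOver A₀ id (Fin.snoc d a : Fin (n + 1) → M) (Fin.snoc d (ρ a)) := by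
    have := eqQFTypeOver_id_of_isQFEmbOn hρ hρA₀ (Fin.snoc d a : Fin (n + 1) → M)
    rwa [Fin.comp_snoc, show (ρ : M → M) ∘ d = d from funext hρd] at this
  have h4 := hiso _ h3 v hvS
  simp only [Function.id_comp] at h4
  -- apply `ρ⁻¹` : `qftp(v, d, ρ a) = qftp(σ, d, a)`
  have h5 := h4.map_right hρsymm
  have e5 : (ρ.symm : M → M) ∘ Fin.append v (Fin.snoc d (ρ a) : Fin (n + 1) → M) =
      Fin.append σ (Fin.snoc d a) := by
    rw [comp_append', Fin.comp_snoc]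
    congr 1
    · funext i
      simp only [Function.comp_apply, Equiv.symm_apply_eq]
      exact (hρσ i).symm
    · rw [Equiv.symm_apply_apply]
      congr 1
      funext i
      simp only [Function.comp_apply, Equiv.symm_apply_eq]
      exact (hρd i).symm
  rw [e5] at h5
  -- so `qftp(σ, d, a) = qftp(v, d, a)`; apply `π` to the right
  have h6 := h5.symm.map_right hπ
  have e6 : (π : M → M) ∘ Fin.append v (Fin.snoc d a : Fin (n + 1) → M) =
      Fin.append (γ ∘ σ) (Fin.snoc d' (π a)) := by
    rw [comp_append', Fin.comp_snoc]
    congr 1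
    · funext i; exact hπv i
    · congr 1
      funext i; exact hπd i
  rwa [e6] at h6

/-! ### Inverting the datum -/

/-- The hypotheses of `crown_forth` are symmetric under passing to the inverse of `γ` on the
crown. [folklore] -/
theorem crown_datum_inverse (hP : IsPregeometry cl) {S : Finset ℕ} {i₀ : ℕ} (hi₀ : i₀ ∈ S)
    (hT : (S.erase i₀).Nonempty) {γ : M → M} (hγ : IsQFEmbOn L γ (crown cl b S))
    (hγT : ∀ z ∈ crown cl b (S.erase i₀), γ z = z) (hγF : γ '' face cl b i₀ = face cl b i₀)
    (hγb : ∀ j, γ (b j) = b j) :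
    ∃ γ' : M → M, (∀ z ∈ crown cl b S, γ' (γ z) = z) ∧ (∀ z ∈ crown cl b S, γ (γ' z) = z) ∧
      γ '' crown cl b S = crown cl b S ∧ γ' '' crown cl b S = crown cl b S ∧
      IsQFEmbOn L γ' (crown cl b S) ∧ (∀ z ∈ crown cl b (S.erase i₀), γ' z = z) ∧
      γ' '' face cl b i₀ = face cl b i₀ ∧ ∀ j, γ' (b j) = b j := by
  classical
  haveI : Nonempty M := ⟨b 0⟩
  have hS2 : 2 ≤ S.card := by
    have h1 := Finset.card_pos.2 hT
    rw [Finset.card_erase_of_mem hi₀] at h1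
    omega
  have himg : γ '' crown cl b S = crown cl b S := by
    rw [crown_eq_union_erase hi₀, image_union, hγF]
    congr 1
    refine (image_congr fun z hz => hγT z hz).trans (image_id _) |>.trans ?_
    rfl
  set γ' := Function.invFunOn γ (crown cl b S) with hγ'def
  have hinv : ∀ z ∈ crown cl b S, γ' (γ z) = z := fun z hz => hγ.injOn.leftInvOn_invFunOn hz
  have hinv' : ∀ z ∈ crown cl b S, γ (γ' z) = z := by
    intro z hz
    rw [← himg] at hz
    obtain ⟨w, hw, rfl⟩ := hz
    rw [hinv w hw]
  have himg' : γ' '' crown cl b S = crown cl b S := by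
    apply Subset.antisymm
    · rintro _ ⟨z, hz, rfl⟩
      rw [← himg] at hz
      obtain ⟨w, hw, rfl⟩ := hz
      rw [hinv w hw]
      exact hw
    · intro z hz
      exact ⟨γ z, himg ▸ mem_image_of_mem γ hz, hinv z hz⟩
  refine ⟨γ', hinv, hinv', himg, himg', ?_, ?_, ?_, ?_⟩
  · have := hγ.inverse (g := γ') hinv
    rwa [himg] at this
  · intro z hz
    have hzS : z ∈ crown cl b S := crown_mono (Finset.erase_subset _ _) hz
    conv_lhs => rw [← hγT z hz]
    exact hinv z hzS
  · have hFS : face cl b i₀ ⊆ crown cl b S := face_subset_crown hi₀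
    apply Subset.antisymm
    · rintro _ ⟨z, hz, rfl⟩
      have hz' : z ∈ γ '' face cl b i₀ := by rw [hγF]; exact hz
      obtain ⟨w, hw, rfl⟩ := hz'
      rw [hinv w (hFS hw)]
      exact hw
    · intro z hz
      refine ⟨γ z, by rw [← hγF]; exact mem_image_of_mem γ hz, hinv z (hFS hz)⟩
  · intro j
    have hj : b j ∈ crown cl b S := apply_mem_crown_of_two_le hP hS2 j
    conv_lhs => rw [← hγb j]
    exact hinv _ hj

/-! ### Extension across the last face: the back-and-forth -/

/-- **Kirby 2010, Lemma 3.2, normalised form.** With `S ∋ i₀`, `T = S ∖ {i₀} ≠ ∅`: a partial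
embedding `γ` on the crown `∂_S M` which is the identity on `∂_T M`, maps `∂_{i₀}` onto itself
and fixes the basis extends to an automorphism of `M`. Proof: countable back-and-forth
(`exists_map_of_backAndForth`) on the relation "`γ ∪ (x ↦ y)` is a partial embedding", with
`crown_forth` in both directions. [cite: Kirby2010QMEC, Lemma 3.2] [cite: BHHKK2014, Prop. 6.2] -/
theorem exists_equiv_extend_crown_step [Countable M]
    (hW : IsWeaklyQuasiminimalPregeometryStructure L M cl) (hb : IndepFamilyOver cl ∅ b)
    (hsp : cl (range b) = univ) {S : Finset ℕ} {i₀ : ℕ} (hi₀ : i₀ ∈ S)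
    (hT : (S.erase i₀).Nonempty) {γ : M → M} (hγ : IsQFEmbOn L γ (crown cl b S))
    (hγT : ∀ z ∈ crown cl b (S.erase i₀), γ z = z) (hγF : γ '' face cl b i₀ = face cl b i₀)
    (hγb : ∀ j, γ (b j) = b j) :
    ∃ Γ : M ≃ M, IsQFEmbOn L Γ univ ∧ (∀ z ∈ crown cl b S, Γ z = γ z) ∧ ∀ j, Γ (b j) = b j := by
  classical
  have hP := hW.isPregeometry
  have hS2 : 2 ≤ S.card := by
    have h1 := Finset.card_pos.2 hT
    rw [Finset.card_erase_of_mem hi₀] at h1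
    omega
  obtain ⟨γ', hinv, hinv', himg, himg', hγ', hγ'T, hγ'F, hγ'b⟩ :=
    crown_datum_inverse hP hi₀ hT hγ hγT hγF hγb
  -- the back-and-forth relation
  let R : ∀ n : ℕ, (Fin n → M) → (Fin n → M) → Prop := fun n x y =>
    L.EqQFTypeOver (crown cl b S) γ x y
  have h0 : R 0 Fin.elim0 Fin.elim0 := hγ.eqQFTypeOver_elim0
  have hwd : ∀ ⦃n⦄ ⦃x y : Fin n → M⦄, R n x y → ∀ i j, x i = x j ↔ y i = y j :=
    fun n x y h i j => h.apply_eq_iff i j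
  have forth : ∀ ⦃n⦄ ⦃x y : Fin n → M⦄, R n x y → (∀ i, x i ∈ univ) → (∀ i, y i ∈ univ) →
      ∀ a ∈ (univ : Set M), ∃ a' ∈ (univ : Set M), R (n + 1) (Fin.snoc x a) (Fin.snoc y a') := by
    intro n x y h _ _ a _
    obtain ⟨a', ha'⟩ := hW.crown_forth hb hsp hi₀ hT hγT hγF hγb h a
    exact ⟨a', mem_univ _, ha'⟩
  have back : ∀ ⦃n⦄ ⦃x y : Fin n → M⦄, R n x y → (∀ i, x i ∈ univ) → (∀ i, y i ∈ univ) →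
      ∀ a' ∈ (univ : Set M), ∃ a ∈ (univ : Set M), R (n + 1) (Fin.snoc x a) (Fin.snoc y a') := by
    intro n x y h _ _ a' _
    have h' : L.EqQFTypeOver (crown cl b S) γ' y x := by
      have := h.symm_of_inverse hinv
      rwa [himg] at this
    obtain ⟨a, ha⟩ := hW.crown_forth hb hsp hi₀ hT hγ'T hγ'F hγ'b h' a'
    have := ha.symm_of_inverse hinv'
    rw [himg'] at this
    exact ⟨a, mem_univ _, this⟩
  obtain ⟨g, hgim, hcov⟩ := exists_map_of_backAndForth (S := R) (countable_univ (α := M))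
    countable_univ h0 hwd forth back
  -- `g` preserves quantifier-free types of all finite tuples
  have hg : IsQFEmbOn L g univ := by
    intro m σ _
    obtain ⟨n, x, y, hxy, -, -, ι, hx, hy⟩ := hcov σ fun _ => mem_univ _
    have := (hxy.eqQFType).comp ι
    rwa [hx, hy] at this
  -- `g` extends `γ` on the crown
  have hgγ : ∀ z ∈ crown cl b S, g z = γ z := by
    intro z hz
    obtain ⟨n, x, y, hxy, -, -, ι, hx, hy⟩ := hcov ![z] fun _ => mem_univ _
    have hx0 : z = x (ι 0) := by simpa using (congr_fun hx 0).symm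
    have := hxy.apply_eq_of_mem hz hx0
    rw [this]
    simpa using (congr_fun hy 0).symm
  have hbij : Function.Bijective g :=
    ⟨fun a c hac => hg.injOn (mem_univ a) (mem_univ c) hac, fun c => by
      have : c ∈ g '' univ := hgim.symm ▸ mem_univ c
      obtain ⟨a, -, rfl⟩ := this
      exact ⟨a, rfl⟩⟩
  refine ⟨Equiv.ofBijective g hbij, hg, hgγ, fun j => ?_⟩
  show g (b j) = b j
  rw [hgγ _ (apply_mem_crown_of_two_le hP hS2 j), hγb j]

/-! ### The theorem: induction on the number of faces -/

/-- **Partial embeddings on crowns extend to automorphisms** (Kirby 2010, Lemma 3.2 — "every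
closed partial embedding with preimage a countable crown extends to a closed embedding of its
closure" — in the situation of the proof of his Thm 3.3, after identification of the two
structures along an isomorphism matching the bases; excellence supplied by BHHKK 2014,
Prop. 6.2). Let `M` be a countable weakly quasiminimal pregeometry structure with basis
`b : ℕ → M`, `S` a nonempty finite set of indices, and `γ` a partial embedding on the crown
`∂_S M = ⋃_{i ∈ S} ∂ᵢ M` with `γ '' ∂ᵢ M = ∂ᵢ M` for `i ∈ S` and `γ (b j) = b j` for all `j`.
Then there is an automorphism `Γ` of `M` agreeing with `γ` on `∂_S M` and fixing the basis.
[cite: Kirby2010QMEC, Lemma 3.2] [cite: BHHKK2014, Prop. 6.2] -/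
theorem exists_equiv_extend_crown [Countable M]
    (hW : IsWeaklyQuasiminimalPregeometryStructure L M cl) (hb : IndepFamilyOver cl ∅ b)
    (hsp : cl (range b) = univ) {S : Finset ℕ} (hS : S.Nonempty) {γ : M → M}
    (hγ : IsQFEmbOn L γ (crown cl b S)) (hγF : ∀ i ∈ S, γ '' face cl b i = face cl b i)
    (hγb : ∀ j, γ (b j) = b j) :
    ∃ Γ : M ≃ M, IsQFEmbOn L Γ univ ∧ (∀ z ∈ crown cl b S, Γ z = γ z) ∧ ∀ j, Γ (b j) = b j := by
  classical
  have hP := hW.isPregeometry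
  -- induction on `|S| = k + 1`
  suffices H : ∀ (k : ℕ) (S : Finset ℕ), S.card = k + 1 → ∀ (γ : M → M),
      IsQFEmbOn L γ (crown cl b S) → (∀ i ∈ S, γ '' face cl b i = face cl b i) →
        (∀ j, γ (b j) = b j) →
          ∃ Γ : M ≃ M, IsQFEmbOn L Γ univ ∧ (∀ z ∈ crown cl b S, Γ z = γ z) ∧ ∀ j, Γ (b j) = b j by
    obtain ⟨k, hk⟩ : ∃ k, S.card = k + 1 := ⟨S.card - 1, by have := Finset.card_pos.2 hS; omega⟩
    exact H k S hk γ hγ hγF hγb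
  intro k
  induction k with
  | zero =>
    intro S hS1 γ hγ hγF hγb
    obtain ⟨i, rfl⟩ := Finset.card_eq_one.1 hS1
    rw [crown_singleton] at hγ ⊢
    have hFi := hγF i (Finset.mem_singleton_self i)
    have hFc : cl (face cl b i) = face cl b i := cl_face hP b i
    have hG : (cl (face cl b i) = face cl b i ∧ cl (γ '' face cl b i) = γ '' face cl b i) ∨
        face cl b i = ∅ := Or.inl ⟨hFc, by rw [hFi]; exact hFc⟩
    -- `bᵢ ↦ bᵢ` is generic on both sides
    have hgen : L.EqQFTypeOver (face cl b i) γ ![b i] ![b i] :=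
      hW.uniqueness_of_generic_type (face cl b i) γ (to_countable _) hFc (by rw [hFi]; exact hFc)
        hγ.eqQFTypeOver_elim0 (apply_notMem_face hb i) (by rw [hFi]; exact apply_notMem_face hb i)
    obtain ⟨F, hF, hFγ, hFb, hFim⟩ := hW.exists_isQFEmbOn_cl_extend (to_countable _) hG hgen
    have huniv : cl (face cl b i ∪ range ![b i]) = univ := cl_face_union_singleton hP hsp i
    rw [huniv] at hF hFim
    rw [hFi, huniv] at hFim
    have hbij : Function.Bijective F :=
      ⟨fun a c hac => hF.injOn (mem_univ a) (mem_univ c) hac, fun c => by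
        have : c ∈ F '' univ := hFim.symm ▸ mem_univ c
        obtain ⟨a, -, rfl⟩ := this
        exact ⟨a, rfl⟩⟩
    refine ⟨Equiv.ofBijective F hbij, hF, fun z hz => hFγ hz, fun j => ?_⟩
    show F (b j) = b j
    by_cases hji : j = i
    · subst hji; simpa using hFb 0
    · rw [hFγ (apply_mem_face hP hji), hγb j]
  | succ k ih =>
    intro S hScard γ hγ hγF hγb
    obtain ⟨i₀, hi₀⟩ : S.Nonempty := Finset.card_pos.1 (by omega)
    set T := S.erase i₀ with hTdef
    have hTcard : T.card = k + 1 := by rw [hTdef, Finset.card_erase_of_mem hi₀, hScard]; rfl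
    have hT : T.Nonempty := Finset.card_pos.1 (by omega)
    have hTS : T ⊆ S := Finset.erase_subset _ _
    -- extend `γ|∂_T` by induction
    obtain ⟨ΓT, hΓT, hΓTγ, hΓTb⟩ := ih T hTcard γ (hγ.mono (crown_mono hTS))
      (fun i hi => hγF i (hTS hi)) hγb
    have hΓTsymm := isQFEmbOn_symm hΓT
    -- normalise: `γ₁ = Γ_T⁻¹ ∘ γ` is the identity on `∂_T`
    set γ₁ : M → M := fun z => ΓT.symm (γ z) with hγ₁def
    have hγ₁ : IsQFEmbOn L γ₁ (crown cl b S) := hγ.comp (hΓTsymm.mono (subset_univ _))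
    have hγ₁T : ∀ z ∈ crown cl b T, γ₁ z = z := fun z hz => by
      simp only [hγ₁def, Equiv.symm_apply_eq]
      exact (hΓTγ z hz).symm
    have hΓTsb : ∀ j, ΓT.symm (b j) = b j := fun j => by
      rw [Equiv.symm_apply_eq]; exact (hΓTb j).symm
    have hγ₁F : γ₁ '' face cl b i₀ = face cl b i₀ := by
      have : γ₁ '' face cl b i₀ = ΓT.symm '' (γ '' face cl b i₀) := by
        rw [← image_comp]; rfl
      rw [this, hγF i₀ hi₀]
      exact image_face_eq_of_fix hW hΓTsymm fun j _ => hΓTsb j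
    have hγ₁b : ∀ j, γ₁ (b j) = b j := fun j => by
      simp only [hγ₁def, hγb j, hΓTsb j]
    obtain ⟨Γ₁, hΓ₁, hΓ₁γ, hΓ₁b⟩ :=
      hW.exists_equiv_extend_crown_step hb hsp hi₀ hT hγ₁ hγ₁T hγ₁F hγ₁b
    refine ⟨Γ₁.trans ΓT, isQFEmbOn_trans hΓ₁ hΓT, fun z hz => ?_, fun j => ?_⟩
    · simp only [Equiv.trans_apply, hΓ₁γ z hz, hγ₁def, Equiv.apply_symm_apply]
    · simp only [Equiv.trans_apply, hΓ₁b j, hΓTb j]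

end IsWeaklyQuasiminimalPregeometryStructure

end Literature.ModelTheory.Quasiminimal

end
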